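import Literature.MathematicalPhysics.QuantumFieldTheory.Balaban1983to89.Node00.LargeFieldBackgroundCoPOfRecordFaces
import Literature.MathematicalPhysics.QuantumFieldTheory.Balaban1983to89.Node00.LargeFieldBackgroundCoPOfRecordB

/-!
# NODE 00 — FILE 22′bᴮ: the `Ω₁ = ∅` step-zero faces of the support-edition background OVER PRINT's DATUM [II] (2.3)
# (`UbgMSCoPOfRecord(At)B` at the all-large-field sequence; theorem-only, no new notion)

Cell `pub-ymgap`, seat `pub-ymgap-node00-def-R` (g22), (E1) variant (iii-b) of record (director-ym №338 ∕ №339 (α) ∕ №341 ∕ №342 ∕ №343 (D3)),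
WORKPLAN-IIIB STAGE 2, additive part S2c.  [III] = [Balaban1988Convergent], [15] = [Balaban1985Variational], [6] = [Balaban1985RegularSpaces],
[II] = [Balaban1984PropagatorsII].

WHAT.  The print-datum twin of `Node00/LargeFieldBackgroundCoPOfRecordFaces.lean` §3 (:178–:267).  The one observation that carries it (§1): at a
sequence with `Ω₁ = ∅` and ONE level, print's datum `lamBondsSeq Ω 1` ([II] (2.3): `Λ₀ = Ω₁ᶜ = T`, `Λ₁ = Ω₁^{(1)} = ∅`) and the (b)-datum
`bondsDet (genSet Ω 1)` COINCIDE — the (2.3) exclusion «no end-point deep in `Ω₁`» is vacuous when `Ω₁ = ∅` — so by FILE 1ᴮ §2 (`rfl` bridges)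
`UminOfRecordB av reg (lamBondsSeq Ω 1) = UminOfRecord av reg (genSet Ω 1)` and the support-edition backgrounds of the two data AGREE at `k = 1`
(§2: `UbgMSCoPOfRecord(At)B_one_eq_of_Omega_empty`).  §3 then reads every (b) face of FILE 22′b §3 across that equality, under B-NAMES:
`mem_solvableDomB_regMSCoPAt_lamBondsSeq_one_iff_of_Omega_empty`, `mem_solvableDomB_regMSCoP_lamBondsSeq_one_of_Omega_empty`,
`solvableDomB_regMSCoP_lamBondsSeq_one_eq_univ_of_Omega_empty`, `UbgMSCoPOfRecordB_one_of_Omega_empty` (`U₁(s)(𝐖) = 𝐖 0` for EVERY `𝐖`, no regularity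
hypothesis), `UbgMSCoPOfRecordAtB_one_of_Omega_empty{_of_mem, , _of_not_mem}`, and the junctions with FILE 22's ∕ FILE 16's editions
(`UbgMSCoOfRecord_one_eq_UbgMSCoPOfRecordB_one_of_Omega_empty_of_mem`, `UbgMSOfRecord_one_eq_UbgMSCoPOfRecordB_one_of_Omega_empty`,
`UbgMSCoPOfRecord_one_of_Omega_empty_of_not_mem_CoB`).  HONESTY GUARD (№338 (5)): print-datum twin of the `Ω₁ = ∅` faces of `UbgMSCoPOfRecord(At)`
(FLAG №16 ∕ LOCATE-HSEAM 5d3298b8d191f169); the (b) faces stay landed and true on their own text; nothing displayed is deleted or weakened — this file only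
ADDS the print-datum readings, each PROVED from the (b) one through the `k = 1` coincidence of the data.

WHAT THIS FILE IS NOT.  Nothing of Bałaban's is asserted ([15] Thm 1 NOT invoked: at `Ω₁ = ∅` the constraint set is `{𝐖 0}` and no minimisation is left).
Purely ADDITIVE; no measurability ∕ selector content (def-T's `Record12MinimiserSelectionB`, n11-d's T1-b); the record `Record13CoP.UbgOfRecord₁₃CoP` is NOT
re-pointed by this file.  No `instance`, no `notation`, no `sorry`.  HONEST FRAMING: definitions of record; counts unmoved (8∕28 · K 1∕4); K0⁷ stub 1 NOT
closed; finite 𝕋⁴ at fixed ε; NOT continuum ∕ OS ∕ mass-gap ∕ Clay.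
-/

noncomputable section

namespace Literature.MathematicalPhysics.QuantumFieldTheory.Balaban1983to89.Node00

open Literature.MathematicalPhysics.QuantumFieldTheory.Balaban1983to89
open T4Continuum B15DeterminingSets B15DeterminingSetsB

/-! ## §1  At `Ω₁ = ∅` with one level, print's datum IS the (b)-datum -/

section DatumAtAllLarge

variable {P : Params}

/-- **[II] (2.3) AT THE ALL-LARGE-FIELD ONE-LEVEL SEQUENCE**: `lamBondsSeq Ω 1 = bondsDet (genSet Ω 1)` when `Ω₁ = ∅` — the exclusion «no end-point
whose `1`-block lies among the `1`-points of `Ω₁`» is vacuous (`Ω₁^{(1)} = ∅`), and above level `0` there is no exclusion at all.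
[cite: Balaban1984PropagatorsII, (2.3) p.224; Balaban1988Convergent, (2.2) p.255] -/
theorem lamBondsSeq_one_eq_bondsDet_genSet_of_Omega_empty (Ω : ℕ → Set (Site P 0)) (hΩ : Ω 1 = ∅) :
    lamBondsSeq Ω 1 = bondsDet (genSet Ω 1) := by
  funext j
  ext b
  rw [mem_lamBondsSeq_iff, bondsDet_apply]
  constructor
  · exact fun h => h.1
  · intro h
    refine ⟨h, fun hj => ?_⟩
    obtain rfl : j = 0 := Nat.lt_one_iff.1 hj
    rw [hΩ, pts_emptySet]
    exact ⟨fun h => h, fun h => h⟩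

variable {G : Type*} [GaugeGroup G] (av : ∀ j, Averaging P j G) (reg : Set (GaugeField P 0 G))

/-- Hence the bond-level minimality predicate at print's datum IS the (b) one at `genSet Ω 1` (`Ω₁ = ∅`). [cite: Balaban1988Convergent, (2.12) p.256; Balaban1984PropagatorsII, (2.3) p.224] -/
theorem isMinimizerB_lamBondsSeq_one_eq_of_Omega_empty (Ω : ℕ → Set (Site P 0)) (hΩ : Ω 1 = ∅) :
    IsMinimizerB av reg (lamBondsSeq Ω 1) = IsMinimizer av reg (genSet Ω 1) := by
  rw [lamBondsSeq_one_eq_bondsDet_genSet_of_Omega_empty Ω hΩ, isMinimizer_eq_isMinimizerB_bondsDet]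

/-- … the solvable sets coincide … [cite: Balaban1988Convergent, (2.12) p.256 (bookkeeping)] -/
theorem solvableDomB_lamBondsSeq_one_eq_of_Omega_empty (Ω : ℕ → Set (Site P 0)) (hΩ : Ω 1 = ∅) :
    solvableDomB av reg (lamBondsSeq Ω 1) = solvableDom av reg (genSet Ω 1) := by
  rw [lamBondsSeq_one_eq_bondsDet_genSet_of_Omega_empty Ω hΩ, solvableDomB_bondsDet]

variable [MeasurableSpace G]

/-- … and so do the TOTAL solution maps of record: `UminOfRecordB av reg (lamBondsSeq Ω 1) = UminOfRecord av reg (genSet Ω 1)` (`Ω₁ = ∅`).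
[cite: Balaban1988Convergent, (2.12)–(2.13) pp.256–257 (bookkeeping); Balaban1984PropagatorsII, (2.3) p.224] -/
theorem UminOfRecordB_lamBondsSeq_one_eq_of_Omega_empty (Ω : ℕ → Set (Site P 0)) (hΩ : Ω 1 = ∅) :
    UminOfRecordB av reg (lamBondsSeq Ω 1) = UminOfRecord av reg (genSet Ω 1) := by
  rw [lamBondsSeq_one_eq_bondsDet_genSet_of_Omega_empty Ω hΩ, UminOfRecordB_bondsDet]

end DatumAtAllLarge

variable {F : T4Family} {N : ℕ} [NeZero N]

/-! ## §2  The two support-edition backgrounds agree at `k = 1`, `Ω₁ = ∅` -/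

section Junction

/-- **ON A SUPPORT `Ω₀`, AT `Ω₁(s) = ∅`: the print-datum background IS the (b)-datum background** (as maps). [cite: Balaban1988Convergent, (2.12)–(2.13) pp.256–257; Balaban1984PropagatorsII, (2.3) p.224] -/
theorem UbgMSCoPOfRecordAtB_one_eq_of_Omega_empty (ν : Stage7Numerics) (M : ℕ) (g : ℕ → ℝ) (K : ℕ) (Ω₀ : Set (Site (F.P K) 0))
    (s : SeqOfRecord F ν M g K 1) (hΩ : s.Ω 1 = ∅) : UbgMSCoPOfRecordAtB F N ν M g K 1 Ω₀ s = UbgMSCoPOfRecordAt F N ν M g K 1 Ω₀ s := by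
  funext W
  rw [UbgMSCoPOfRecordAtB_apply, UbgMSCoPOfRecordAt_apply, UminOfRecordB_lamBondsSeq_one_eq_of_Omega_empty _ _ s.Ω hΩ]

/-- **OF RECORD (support `Ω₀(s)`), AT `Ω₁(s) = ∅`: the print-datum background IS the (b)-datum background.** [cite: Balaban1988Convergent, (2.12)–(2.13) pp.256–257; Balaban1984PropagatorsII, (2.3) p.224] -/
theorem UbgMSCoPOfRecordB_one_eq_of_Omega_empty (ν : Stage7Numerics) (M : ℕ) (g : ℕ → ℝ) (K : ℕ) (s : SeqOfRecord F ν M g K 1) (hΩ : s.Ω 1 = ∅) :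
    UbgMSCoPOfRecordB F N ν M g K 1 s = UbgMSCoPOfRecord F N ν M g K 1 s := by
  rw [UbgMSCoPOfRecordB_eq_At, UbgMSCoPOfRecord_eq_At, UbgMSCoPOfRecordAtB_one_eq_of_Omega_empty ν M g K _ s hΩ]

end Junction

/-! ## §3  The faces of FILE 22′b §3, read at print's datum -/

section BackgroundAtAllLarge

/-- **THE SOLVABLE SET ON A SUPPORT AT `Ω₁ = ∅`, READ AT PRINT's DATUM**: a minimal configuration over the class on `Ω₀` exists iff `𝐖 0` lies in that class.
[cite: Balaban1988Convergent, (2.2) p.255, (2.12) p.256; Balaban1985Variational, (6) p.278; Balaban1984PropagatorsII, (2.3) p.224] -/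
theorem mem_solvableDomB_regMSCoPAt_lamBondsSeq_one_iff_of_Omega_empty (ν : Stage7Numerics) (K : ℕ) (Ω₀ : Set (Site (F.P K) 0))
    (Ω : ℕ → Set (Site (F.P K) 0)) (hΩ : Ω 1 = ∅) (W : MSField (F.P K) (SU N)) :
    W ∈ solvableDomB (avOfRecord F N K) (regMSCoPOfRecordAt F N ν K 1 Ω₀ Ω) (lamBondsSeq Ω 1) ↔ W 0 ∈ regMSCoPOfRecordAt F N ν K 1 Ω₀ Ω := by
  rw [solvableDomB_lamBondsSeq_one_eq_of_Omega_empty _ _ Ω hΩ]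
  exact mem_solvableDom_regMSCoPAt_genSet_one_iff_of_Omega_empty ν K Ω₀ Ω hΩ W

/-- **OF RECORD, EVERY RETAINED CONFIGURATION IS SOLVABLE AT `Ω₁ = ∅`** over print's datum (membership form).
[cite: Balaban1988Convergent, (2.12) p.256; Balaban1985Variational, (3),(6) p.278; Balaban1984PropagatorsII, (2.3) p.224] -/
theorem mem_solvableDomB_regMSCoP_lamBondsSeq_one_of_Omega_empty (ν : Stage7Numerics) (K : ℕ) (Ω : ℕ → Set (Site (F.P K) 0)) (hΩ : Ω 1 = ∅)
    (W : MSField (F.P K) (SU N)) : W ∈ solvableDomB (avOfRecord F N K) (regMSCoPOfRecord F N ν K 1 Ω) (lamBondsSeq Ω 1) := by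
  rw [solvableDomB_lamBondsSeq_one_eq_of_Omega_empty _ _ Ω hΩ]
  exact mem_solvableDom_regMSCoP_genSet_one_of_Omega_empty ν K Ω hΩ W

/-- … set form: the print-datum solvable set of record at `Ω₁ = ∅` is all of `MSField`. [cite: Balaban1988Convergent, (2.12) p.256 (bookkeeping)] -/
theorem solvableDomB_regMSCoP_lamBondsSeq_one_eq_univ_of_Omega_empty (ν : Stage7Numerics) (K : ℕ) (Ω : ℕ → Set (Site (F.P K) 0)) (hΩ : Ω 1 = ∅) :
    solvableDomB (avOfRecord F N K) (regMSCoPOfRecord F N ν K 1 Ω) (lamBondsSeq Ω 1) = Set.univ := by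
  rw [solvableDomB_lamBondsSeq_one_eq_of_Omega_empty _ _ Ω hΩ]
  exact solvableDom_regMSCoP_genSet_one_eq_univ_of_Omega_empty ν K Ω hΩ

/-- **THE PRINT-DATUM SUPPORT-EDITION BACKGROUND OF RECORD AT THE ALL-LARGE-FIELD SEQUENCE IS THE FINE FIELD — UNCONDITIONALLY**: at `Ω₁(s) = ∅`,
`U_1(s)(𝐖) = 𝐖 0` for EVERY retained configuration `𝐖` (print's `U₁ = V₀` on `Λ₀ = T`; no regularity hypothesis; [15] Thm 1 not invoked).
[cite: Balaban1988Convergent, (2.12)–(2.13) pp.256–257; Balaban1985Variational, (3) p.278, Thm 1 (8) p.279; Balaban1984PropagatorsII, (2.3) p.224] -/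
theorem UbgMSCoPOfRecordB_one_of_Omega_empty (ν : Stage7Numerics) (M : ℕ) (g : ℕ → ℝ) (K : ℕ) (s : SeqOfRecord F ν M g K 1) (hΩ : s.Ω 1 = ∅)
    (W : MSField (F.P K) (SU N)) : UbgMSCoPOfRecordB F N ν M g K 1 s W = W 0 := by
  rw [UbgMSCoPOfRecordB_one_eq_of_Omega_empty ν M g K s hΩ]
  exact UbgMSCoPOfRecord_one_of_Omega_empty ν M g K s hΩ W

/-- **ON A SUPPORT `Ω₀`** (membership form): at `Ω₁(s) = ∅`, `U_1(s)(𝐖) = 𝐖 0` whenever `𝐖 0` lies in the class on `Ω₀`.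
[cite: Balaban1988Convergent, (2.12)–(2.13) pp.256–257; Balaban1985Variational, Thm 1 (8) p.279] -/
theorem UbgMSCoPOfRecordAtB_one_of_Omega_empty_of_mem (ν : Stage7Numerics) (M : ℕ) (g : ℕ → ℝ) (K : ℕ) (Ω₀ : Set (Site (F.P K) 0))
    (s : SeqOfRecord F ν M g K 1) (hΩ : s.Ω 1 = ∅) (W : MSField (F.P K) (SU N)) (hW : W 0 ∈ regMSCoPOfRecordAt F N ν K 1 Ω₀ s.Ω) :
    UbgMSCoPOfRecordAtB F N ν M g K 1 Ω₀ s W = W 0 := by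
  rw [UbgMSCoPOfRecordAtB_one_eq_of_Omega_empty ν M g K Ω₀ s hΩ]
  exact UbgMSCoPOfRecordAt_one_of_Omega_empty_of_mem ν M g K Ω₀ s hΩ W hW

/-- **… WITH THE CLASS DISPLAYED**: (1.7) on the plaquettes of `Ω₀` at `εreg·η₀²` ∧ (1.9) on the bonds of `Ω₀` at `εreg·η₀³`, read at `𝐖 0`.
[cite: Balaban1985RegularSpaces, (1.7),(1.9) p.77 (j = 0); Balaban1988Convergent, (2.12) p.256] -/
theorem UbgMSCoPOfRecordAtB_one_of_Omega_empty (ν : Stage7Numerics) (M : ℕ) (g : ℕ → ℝ) (K : ℕ) (Ω₀ : Set (Site (F.P K) 0))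
    (s : SeqOfRecord F ν M g K 1) (hΩ : s.Ω 1 = ∅) (W : MSField (F.P K) (SU N))
    (hW7 : PlaqSmallOn (B8Eq17ClassAkV1.plaqsOf Ω₀) (ν.εreg * (F.P K).eta 0 ^ 2) (W 0))
    (hW9 : Sect2.CoDivSmallOn (bondsOf Ω₀) (ν.εreg * (F.P K).eta 0 ^ 3) (W 0)) : UbgMSCoPOfRecordAtB F N ν M g K 1 Ω₀ s W = W 0 := by
  rw [UbgMSCoPOfRecordAtB_one_eq_of_Omega_empty ν M g K Ω₀ s hΩ]
  exact UbgMSCoPOfRecordAt_one_of_Omega_empty ν M g K Ω₀ s hΩ W hW7 hW9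

/-- … and OFF the class on `Ω₀` it is the junk unit configuration (the print-datum solvable set is empty there: FILE 1ᴮ's totalisation).
[cite: Balaban1988Convergent, (2.12) p.256 (typing convention)] -/
theorem UbgMSCoPOfRecordAtB_one_of_Omega_empty_of_not_mem (ν : Stage7Numerics) (M : ℕ) (g : ℕ → ℝ) (K : ℕ) (Ω₀ : Set (Site (F.P K) 0))
    (s : SeqOfRecord F ν M g K 1) (hΩ : s.Ω 1 = ∅) (W : MSField (F.P K) (SU N)) (hW : W 0 ∉ regMSCoPOfRecordAt F N ν K 1 Ω₀ s.Ω) :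
    UbgMSCoPOfRecordAtB F N ν M g K 1 Ω₀ s W = fun _ => 1 := by
  rw [UbgMSCoPOfRecordAtB_one_eq_of_Omega_empty ν M g K Ω₀ s hΩ]
  exact UbgMSCoPOfRecordAt_one_of_Omega_empty_of_not_mem ν M g K Ω₀ s hΩ W hW

/-- **THE LOCATED JUNK EVENT OF THE `T_η`-POSED EDITION DOES NOT OCCUR IN THE PRINT-DATUM SUPPORT EDITION**: where FILE 22's full-class background
returns the unit configuration at `Ω₁ = ∅` (an irregular `𝐖 0`), the print-datum support edition still returns the datum.
[cite: Balaban1988Convergent, (2.12) p.256 (typing convention); Balaban1985Variational, (3) p.278] -/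
theorem UbgMSCoPOfRecord_one_of_Omega_empty_of_not_mem_CoB (ν : Stage7Numerics) (M : ℕ) (g : ℕ → ℝ) (K : ℕ) (s : SeqOfRecord F ν M g K 1)
    (hΩ : s.Ω 1 = ∅) (W : MSField (F.P K) (SU N)) (hW : W 0 ∉ regMSCoOfRecord F N ν K 1 s.Ω) :
    UbgMSCoOfRecord F N ν M g K 1 s W = (fun _ => 1) ∧ UbgMSCoPOfRecordB F N ν M g K 1 s W = W 0 :=
  ⟨UbgMSCoOfRecord_one_of_Omega_empty_of_not_mem ν M g K s hΩ W hW, UbgMSCoPOfRecordB_one_of_Omega_empty ν M g K s hΩ W⟩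

/-- Junction with FILE 22's full-class edition at `Ω₁ = ∅`: where that one returns the datum, the two backgrounds agree.
[cite: Balaban1985RegularSpaces, (1.7),(1.9) p.77; Balaban1988Convergent, (2.12) p.256] -/
theorem UbgMSCoOfRecord_one_eq_UbgMSCoPOfRecordB_one_of_Omega_empty_of_mem (ν : Stage7Numerics) (M : ℕ) (g : ℕ → ℝ) (K : ℕ)
    (s : SeqOfRecord F ν M g K 1) (hΩ : s.Ω 1 = ∅) (W : MSField (F.P K) (SU N)) (hW : W 0 ∈ regMSCoOfRecord F N ν K 1 s.Ω) :
    UbgMSCoOfRecord F N ν M g K 1 s W = UbgMSCoPOfRecordB F N ν M g K 1 s W := by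
  rw [UbgMSCoOfRecord_one_of_Omega_empty_of_mem ν M g K s hΩ W hW, UbgMSCoPOfRecordB_one_of_Omega_empty ν M g K s hΩ W]

/-- Junction with FILE 16's (1.7)-edition at `Ω₁ = ∅`: where that one returns the datum (`𝐖 0` globally (1.7)-small), the two backgrounds agree.
[cite: Balaban1985RegularSpaces, (1.7) p.77; Balaban1988Convergent, (2.12) p.256] -/
theorem UbgMSOfRecord_one_eq_UbgMSCoPOfRecordB_one_of_Omega_empty (ν : Stage7Numerics) (M : ℕ) (g : ℕ → ℝ) (K : ℕ) (s : SeqOfRecord F ν M g K 1)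
    (hΩ : s.Ω 1 = ∅) (W : MSField (F.P K) (SU N)) (hW : PlaqSmall (ν.εreg * (F.P K).eta 0 ^ 2) (W 0)) :
    UbgMSOfRecord F N ν M g K 1 s W = UbgMSCoPOfRecordB F N ν M g K 1 s W := by
  rw [UbgMSOfRecord_one_of_Omega_empty ν M g K s hΩ W hW, UbgMSCoPOfRecordB_one_of_Omega_empty ν M g K s hΩ W]

end BackgroundAtAllLarge

end Literature.MathematicalPhysics.QuantumFieldTheory.Balaban1983to89.Node00
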